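import Summits.RiemannHypothesis.RiemannHypothesis.Theorems.PfPersistenceDilatingLandauWeighted
import Literature.NumberTheory.LFunctions.GeneralizedRH
import HarnessLib

/-!
# LANDAU for the `n^{-1/2}`-weighted dilating statistic `S(x) = Σ_{n ≤ x} Λ(n)/√n` — III: dictionary

Cell `pub-rhpf` (mechanism/rigidity campaign; **no RH claims**), CAND SEAT 7 gen 8, CASE-DAG v6 §6
kernel target LANDAU, weighted statistic, file 3 of 3: the cell-facing ONE-SIDED DICTIONARY for
`S(x) − 2√x`, read off MV 15.3 for `S` (file 2, `WeightedLandau.false_of_eventually_le`).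

* `re_le_of_wpsi_oneSided`: a one-sided bound `η (S(x) − 2√x) ≤ A x^τ` for all large `x`
  (`η = ±1`, `τ ≥ 0`) forces every zero of `ζ` to have `Re ρ ≤ 1/2 + τ`, i.e.
  `QuasiRiemannHypothesis (1/2 + τ)` (`quasiRiemannHypothesis_of_wpsi_oneSided`);
* at `τ = 0`: **a one-sided `O(1)` bound on `S(x) − 2√x` (either side) implies RH**
  (`riemannHypothesis_of_wpsi_oneSided_bdd`, `riemannHypothesis_of_wpsi_le`,
  `riemannHypothesis_of_le_wpsi`);
* `exists_wpsiErr_oscillation_of_not_riemannHypothesis`: off RH, `S(x) − 2√x = Ω±(x^δ)` for some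
  `δ > 0`.

So for the weighted statistic the RH-strength threshold of one-sided readers sits at the CONSTANT
scale (`x^0`), where for `ψ(x) − x` it sat at `x^{1/2}` (`PfPersistenceDilatingLandau`): the weight
`n^{-1/2}` shifts every exponent by `1/2` and nothing else — a one-sided reader of `S` is again never
RH-free-and-sound. (The converse direction, RH ⇒ `S(x) − 2√x = O(log³ x)`, MV Thm. 13.1-type, is
not needed here and not proved.) RH-free, sorry-free.

References: [MontgomeryVaughan2007] H. L. Montgomery, R. C. Vaughan, *Multiplicative Number Theory I*,
CUP 2007, §15.1 (Thm. 15.3), §13.1.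
-/

noncomputable section

-- the sub-problem path RiemannHypothesis/RiemannHypothesis duplicates a namespace (D-0017)
set_option linter.dupNamespace false

open Complex Filter Topology Set

namespace Summit.RiemannHypothesis.RiemannHypothesis.Theorems.PfPersistenceDilatingLandauWeightedDictionary

open Literature.NumberTheory.LFunctions
open Summit.RiemannHypothesis.RiemannHypothesis.Theorems.PfPersistenceDilatingLandauWeightedMellin
open Summit.RiemannHypothesis.RiemannHypothesis.Theorems.PfPersistenceDilatingLandauWeighted

/-! ## §5 The one-sided dictionary for `S` (cell-facing; RH-free) -/

/-- **One-sided power-scale bound on `S(x) − 2√x` ⇒ zeros confined.** If `η (S(x) − 2√x) ≤ A x^τ`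
for all large `x` (`η = ±1`, `τ ≥ 0`), then every zero of `ζ` has `Re ρ ≤ 1/2 + τ`.
[cite: MontgomeryVaughan2007, §15.1, Thm. 15.3 (shifted)] -/
theorem re_le_of_wpsi_oneSided {η A τ : ℝ} (hη : η = 1 ∨ η = -1) (hτ : 0 ≤ τ)
    (hev : ∀ᶠ x in atTop, η * wpsiErr x ≤ A * x ^ τ)
    {ρ : ℂ} (h0 : riemannZeta ρ = 0) : ρ.re ≤ 1 / 2 + τ := by
  refine not_lt.1 fun hlt ↦ ?_
  have hre : 1 / 2 < ρ.re := by linarith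
  set s₀ : ℂ := ρ - (1 / 2 : ℝ) with hs₀
  have hs₀0 : s₀ ≠ 0 := by
    intro h
    have := congrArg Complex.re h
    simp [hs₀] at this
    linarith
  have hn : 0 < ‖s₀‖ := norm_pos_iff.2 hs₀0
  have hinv : 0 < 1 / ‖s₀‖ := one_div_pos.2 hn
  set c : ℝ := 1 / ‖s₀‖ / 2 with hcdef
  have hc0 : 0 < c := by positivity
  have hc : c < 1 / ‖s₀‖ := by rw [hcdef]; linarith
  refine WeightedLandau.false_of_eventually_le h0 hre hη hc0 hc ?_
  have hε : 0 < ρ.re - 1 / 2 - τ := by linarith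
  have ht : Tendsto (fun x : ℝ ↦ x ^ (ρ.re - 1 / 2 - τ)) atTop atTop := tendsto_rpow_atTop hε
  filter_upwards [hev, ht.eventually_ge_atTop (A / c), eventually_gt_atTop 0] with x h1 h2 hx
  refine h1.trans ?_
  have hA : A ≤ c * x ^ (ρ.re - 1 / 2 - τ) := by rw [mul_comm]; exact (div_le_iff₀ hc0).1 h2
  have hxτ : 0 ≤ x ^ τ := (Real.rpow_pos_of_pos hx τ).le
  calc A * x ^ τ ≤ c * x ^ (ρ.re - 1 / 2 - τ) * x ^ τ := mul_le_mul_of_nonneg_right hA hxτ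
    _ = c * x ^ (ρ.re - 1 / 2) := by rw [mul_assoc, ← Real.rpow_add hx, sub_add_cancel]

/-- **One-sided `x^τ` bound on `S(x) − 2√x` ⇒ quasi-RH(1/2 + τ)** (`τ ≥ 0`).
[cite: MontgomeryVaughan2007, §15.1, Thm. 15.3 (shifted)] -/
theorem quasiRiemannHypothesis_of_wpsi_oneSided {η A τ : ℝ} (hη : η = 1 ∨ η = -1) (hτ : 0 ≤ τ)
    (hev : ∀ᶠ x in atTop, η * wpsiErr x ≤ A * x ^ τ) : QuasiRiemannHypothesis (1 / 2 + τ) :=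
  fun _s hs hσs _h1 ↦ (not_lt.2 (re_le_of_wpsi_oneSided hη hτ hev hs)) hσs

/-- **A one-sided `O(1)` bound on `S(x) − 2√x` ⇒ RH** (either side, `η = ±1`).
[cite: MontgomeryVaughan2007, §15.1, Thm. 15.3 (shifted); Thm. 13.1] -/
theorem riemannHypothesis_of_wpsi_oneSided_bdd {η A : ℝ} (hη : η = 1 ∨ η = -1)
    (hev : ∀ᶠ x in atTop, η * wpsiErr x ≤ A) : RiemannHypothesis := by
  have hev' : ∀ᶠ x in atTop, η * wpsiErr x ≤ A * x ^ (0 : ℝ) := by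
    filter_upwards [hev] with x hx
    rwa [Real.rpow_zero, mul_one]
  have hq := quasiRiemannHypothesis_of_wpsi_oneSided hη le_rfl hev'
  rw [add_zero] at hq
  exact quasiRiemannHypothesis_one_half_iff_holds.1 hq

/-- **`S(x) ≤ 2√x + A` for all large `x` ⇒ RH.** [cite: MontgomeryVaughan2007, §15.1, Thm. 15.3 (shifted)] -/
theorem riemannHypothesis_of_wpsi_le {A : ℝ}
    (hev : ∀ᶠ x in atTop, wpsi x ≤ 2 * x ^ (1 / 2 : ℝ) + A) : RiemannHypothesis := by
  refine riemannHypothesis_of_wpsi_oneSided_bdd (η := 1) (A := A) (Or.inl rfl) ?_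
  filter_upwards [hev] with x hx
  rw [one_mul, wpsiErr]
  linarith

/-- **`2√x − A ≤ S(x)` for all large `x` ⇒ RH.** [cite: MontgomeryVaughan2007, §15.1, Thm. 15.3 (shifted)] -/
theorem riemannHypothesis_of_le_wpsi {A : ℝ}
    (hev : ∀ᶠ x in atTop, 2 * x ^ (1 / 2 : ℝ) - A ≤ wpsi x) : RiemannHypothesis := by
  refine riemannHypothesis_of_wpsi_oneSided_bdd (η := -1) (A := A) (Or.inr rfl) ?_
  filter_upwards [hev] with x hx
  rw [wpsiErr]
  linarith

/-- **Off RH, `S(x) − 2√x` oscillates at a power scale** (both signs): if RH fails there are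
`δ > 0` and `c > 0` with `S(x) − 2√x ≥ c x^δ` and `S(x) − 2√x ≤ −c x^δ` for unbounded sets of `x`.
[cite: MontgomeryVaughan2007, Thm. 15.3 (shifted)] -/
theorem exists_wpsiErr_oscillation_of_not_riemannHypothesis (hRH : ¬ RiemannHypothesis) :
    ∃ δ c : ℝ, 0 < δ ∧ 0 < c ∧ (∃ᶠ x in atTop, c * x ^ δ ≤ wpsiErr x) ∧
      ∃ᶠ x in atTop, wpsiErr x ≤ -(c * x ^ δ) := by
  by_contra hno
  refine hRH (quasiRiemannHypothesis_one_half_iff_holds.1 fun s hs hσs _h1 ↦ ?_)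
  set s₀ : ℂ := s - (1 / 2 : ℝ) with hs₀
  have hs₀0 : s₀ ≠ 0 := by
    intro h
    have := congrArg Complex.re h
    simp [hs₀] at this
    linarith
  have hn : 0 < ‖s₀‖ := norm_pos_iff.2 hs₀0
  have hinv : 0 < 1 / ‖s₀‖ := one_div_pos.2 hn
  have hw := WeightedLandau.frequently_le_wpsiErr_and_wpsiErr_le hs hσs
    (c := 1 / ‖s₀‖ / 2) (by positivity) (by linarith)
  exact hno ⟨s.re - 1 / 2, 1 / ‖s₀‖ / 2, by linarith, by positivity, hw.1, hw.2⟩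

end Summit.RiemannHypothesis.RiemannHypothesis.Theorems.PfPersistenceDilatingLandauWeightedDictionary

end
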